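import Summits.CriticalPhenomena.PercolationContinuityZ3.Theorems.PercNearOneGluingNoHeavyPcintNawMemZ6M10Check1
import Summits.CriticalPhenomena.PercolationContinuityZ3.Theorems.PercNearOneGluingNoHeavyPcintNawMemZ6M10Check2
import Summits.CriticalPhenomena.PercolationContinuityZ3.Theorems.PercNearOneGluingNoHeavyPcintNawMemZ6M10Check3
import Summits.CriticalPhenomena.PercolationContinuityZ3.Theorems.PercNearOneGluingNoHeavyPcintNawMemZ6M10Check4
import HarnessLib

/-!
# PCINT lane, kernel reduced-state B2r certificate `Z6M10` (d = 6, memory τ = 10, 798 state classes): the theorem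

Cell `prim-pcint`, seat `prim-pcint-1` (gen 5); memo `run/shared/lean/prim/pcint/INTERVAL-PLAN.md` §16 ("checker for the reduced-state
automata").  Does NOT build on p205010.  Data for `NawK.le_siteCriticalProb_of_checkRows` (`…PcintNawRandMemKernelCert`): `p = 10060/100000`,
`q̄ = 99041/100000` (`q̄^11·100000^11 ≥ (100000-10060)·100000^10`), `κ̄ = (100000+99041)/(2·100000)`, `λ = 99999/100000`; Collatz–Wielandt weights (scale 10⁹) from a
power iteration, exact off-line max row ratio 0.9996917089 < λ.  Generated by gen5/gen_lean.py (pcint-1 folder); the kernel re-checks every row.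
-/

namespace Summit.CriticalPhenomena.PercolationContinuityZ3.Theorems.Pcint

open Literature.Probability.Percolation Literature.Probability.LatticeModels

/-- Every row of the certificate passes. [folklore] -/
theorem NawMemZ6M10.all_rows : WinK.allRange NawMemZ6M10.chk 0 798 = true := (WinK.allRange_split (WinK.allRange_split (WinK.allRange_split NawMemZ6M10.file_1 NawMemZ6M10.file_2) NawMemZ6M10.file_3) NawMemZ6M10.file_4)

/-- **`p_c^site(ℤ⁶) ≥ 0.1006`** (kernel-checked reduced-state B2r certificate: memory-`10` dangerous-set automaton,
798 state classes, `decide +kernel` only). [folklore] -/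
theorem siteCriticalProb_Z6_ge_01006 : (0.1006 : ℝ) ≤ siteCriticalProb (zdGraph 6) 0 := by
  have h := NawK.le_siteCriticalProb_of_checkRows (d := 6) (τ := 10) (N := 798) (pn := 10060) (Q := 99041) (D := 100000)
    (lamN := 99999) (lamD := 100000) (syms := NawMemZ6M10.syms) (t := NawMemZ6M10.tree) (by norm_num)
    (fun c => NawK.symOfTab 6 (NawMemZ6M10.syms.getD c [])) (NawK.syms_spec_of_valid NawMemZ6M10.syms_valid)
    (fun i hi => WinK.of_allRange NawMemZ6M10.all_rows (Nat.zero_le i) hi)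
    (by norm_num) (by decide +kernel) (by norm_num) (by norm_num) (by norm_num) (by norm_num) (by norm_num)
  have e : ((10060 : ℕ) : ℝ) / ((100000 : ℕ) : ℝ) = (0.1006 : ℝ) := by norm_num
  rw [e] at h
  exact h

end Summit.CriticalPhenomena.PercolationContinuityZ3.Theorems.Pcint
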